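import Mathlib
import Literature.LinearAlgebra.Matrix.CrossInterpolation
import Literature.LinearAlgebra.Matrix.MaximalVolumePivot
import Literature.Analysis.Matrix.HadamardInequality

/-!
# Dominant submatrices: the exchange rule, `maxvol` termination, quasi-maximal volume

The theory behind the `maxvol` row-exchange algorithm for finding a *dominant* `k × k` block in
a tall `M × k` matrix (Goreinov–Oseledets–Savostyanov–Tyrtyshnikov–Zamarashkin, *How to find a
good submatrix*, 2010), in the formulation of [Osinsky2018, §1 Definition 1, §2.2] and
[MikhalevOseledets2018, §3 Definition 2, §4].  Setting: `A : Matrix m ι K` (its columns are the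
`k = #ι` pivot columns), pivot rows `r : ι → m`, pivot block `P = A.submatrix r id`, coefficient
matrix `C = A P⁻¹`.

* `submatrix_mul_inv_submatrix_pivotRows`, `submatrix_eq_submatrix_mul_inv_mul`,
  `det_submatrix_eq_det_mul_det` — `C[r, :] = 1` and every `k × k` block factors through the
  pivot block, `A[s, :] = C[s, :] P`, so `det A[s, :] = det C[s, :] · det P` (any commutative
  ring);
* `norm_det_submatrix_update` — the EXCHANGE RULE [Osinsky2018, §2.2 Lemma 3],
  [MikhalevOseledets2018, §4]: replacing pivot row `j` by row `i` multiplies the volume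
  `‖det P‖` by `‖C i j‖` (any normed field; from the Cramer form
  `Literature.LinearAlgebra.Matrix.mul_inv_submatrix_apply_mul_det`);
* `forall_norm_det_submatrix_update_le_iff` — the DOMINANCE CRITERION with threshold `c`:
  no single row exchange multiplies the volume by more than `c` iff `‖C‖_max ≤ c`; `c = 1` is
  dominance proper [MikhalevOseledets2018, §3 Definition 2 and §4 eq. `‖C‖_C ≤ 1`],
  [Osinsky2018, §1 Definition 1, §2.2 after Lemma 3], [AllenLaiShen2024, Definition 1];
  `c = 1 + ε` is quasi-dominance [MikhalevOseledets2018, §3], [Osinsky2018, §2.2];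
  `exists_isUnit_det_and_norm_mul_inv_le_one` — a dominant block exists as soon as some block is
  nonsingular (finitely many rows) [AllenLaiShen2024, Lemma 1];
* `mul_norm_det_lt_norm_det_submatrix_update`, `isUnit_det_submatrix_and_le_of_exchanges`,
  `natCast_le_logb_of_exchanges` — TERMINATION OF `maxvol` WITH THRESHOLD `c > 1`
  [Osinsky2018, §2.2]: every exchange on an entry with `‖C i j‖ ≥ c` keeps the block nonsingular
  and multiplies its volume by at least `c`, so after `k` exchanges `c ^ k ‖det P₀‖ ≤ ‖det P_k‖`,
  and if all volumes are `≤ V` then `k ≤ log_c (V / ‖det P₀‖)` (cf. the count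
  `⌈ln Γ / ln c⌉ - 1`, `Γ` = maximal volume / starting volume, of [Osinsky2018, §2.2], which uses
  the strict comparison `|C i j| > c`);
* `norm_det_le_pow_of_norm_entry_le`, `abs_det_le_pow_of_abs_entry_le` — Hadamard:
  `‖det C‖ ≤ (√k · c) ^ k` when all `‖C i j‖ ≤ c` (from
  `Literature.Analysis.Matrix.norm_det_sq_le_of_entry_le`; `ℂ` and `ℝ`);
* `norm_det_submatrix_le_of_norm_mul_inv_le`, `abs_det_submatrix_le_of_abs_mul_inv_le` (and the
  `c = 1` forms `…_of_dominant`, `abs_det_submatrix_le_of_volume_locally_maximal`) —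
  QUASI-MAXIMAL VOLUME OF A (`c`-)DOMINANT BLOCK: if `‖C‖_max ≤ c` then every `k × k` block has
  `‖det A[s, :]‖ ≤ (√k · c) ^ k ‖det P‖`, i.e. the volume of a `c`-dominant block is within the
  factor `c ^ k k ^ {k/2}` of the maximal one [Osinsky2018, Proposition 2 (hypothesis and first
  sentence of the proof)]; for `c = 1`, `|det P| ≥ |det P_max| / k ^ {k/2}`
  [AllenLaiShen2024, Lemma 2]; in particular a block whose volume cannot be increased by ONE row
  exchange is within `k ^ {k/2}` of the block of globally maximal volume;
* `abs_sub_crossInterp_le_of_pivotCols_dominant` — the LEBESGUE-CONSTANT bound of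
  [GoreinovTyrtyshnikov2001, Thm 1.1] (`E_int ≤ (k+1) E_best` on maximal-volume nodes, formalised
  as `Literature.LinearAlgebra.Matrix.abs_sub_crossInterp_le_of_pivotCols_volume_maximal`) with
  the maximal-volume hypothesis relaxed to `γ`-dominance of the nodes, `|P⁻¹ A[r, :]| ≤ γ`
  entrywise: `E_int ≤ (1 + k γ) E_best` (same proof; `γ = 1` is the original).

NOT formalised: the `maxvol` algorithm as a program (only its invariant and its termination count
are stated, over an arbitrary exchange sequence `rs : ℕ → ι → m`), the sharper bound on the
number of exchanges via `α_k ≤ α^{(1-1/r)^k}` [Osinsky2018, §2.2 eq. for `k₂`], rectangular /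
2-volume and projective-volume results ([MikhalevOseledets2018, Thm 4.2 ff.], [Osinsky2018,
Thm 1, Lemma 4, Prop. 2 itself, §2.4–2.5]), singular-value (`σ_{k+1}`) error bounds, and the
coefficient growth of greedy (rook / full-pivoting) crosses.

References: A. I. Osinsky, *Rectangular maximum volume and projective volume search
algorithms*, arXiv:1809.02334 (2018), §1 Definition 1, §2.2 (Lemma 3 and the discussion of the
threshold `c = 1 + ε`), §2.3 Proposition 2; A. Mikhalev, I. V. Oseledets, *Rectangular
maximum-volume submatrices and their applications*, Linear Algebra Appl. 538 (2018) 187–211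
(arXiv:1502.07838), §3 Definitions 2–3, §4; K. Allen, M.-J. Lai, Z. Shen, *Maximal volume matrix
cross approximation for image compression and least squares solution*, Adv. Comput. Math.
(2024), arXiv:2309.17403, §2 Definition 1, Lemmas 1–2; S. A. Goreinov, E. E. Tyrtyshnikov, *The
maximal-volume concept in approximation by low-rank matrices*, Contemp. Math. 280 (2001) 47–51,
Theorem 1.1.  Origin of the dominance lemmas: S. A. Goreinov, I. V. Oseledets,
D. V. Savostyanov, E. E. Tyrtyshnikov, N. L. Zamarashkin, *How to find a good submatrix*, in
*Matrix Methods: Theory, Algorithms and Applications*, World Scientific 2010, 247–256 (text not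
consulted here; statements taken from the three later sources above).
AI-produced formalisation (H21 engines group, seat eng-quad-2, 2026-08-21); no facts, no axioms
beyond Mathlib's, no `sorry`.
-/

open Matrix

namespace Literature.LinearAlgebra.Matrix

/-! ## Factorisation through the pivot block -/

section CommRing

variable {K : Type*} [CommRing K] {m ι : Type*} [Fintype ι] [DecidableEq ι]

/-- [cite: Osinsky2018, §2.2 Lemma 3]; [cite: MikhalevOseledets2018, §4]
The coefficient matrix `C = A P⁻¹` of a nonsingular pivot block `P = A[r, :]` contains the
identity in the pivot rows: `C[r, :] = P P⁻¹ = 1`. -/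
theorem submatrix_mul_inv_submatrix_pivotRows (A : Matrix m ι K) (r : ι → m)
    (hP : IsUnit (A.submatrix r id).det) :
    (A * (A.submatrix r id)⁻¹).submatrix r id = 1 := by
  rw [submatrix_mul A (A.submatrix r id)⁻¹ r id id Function.bijective_id, submatrix_id_id,
    mul_nonsing_inv _ hP]

/-- [cite: Osinsky2018, §2.2 Lemma 3]; [cite: MikhalevOseledets2018, §4]
FACTORISATION THROUGH THE PIVOT BLOCK: for a nonsingular pivot block `P = A[r, :]` of the tall
matrix `A`, every block of rows factors as `A[s, :] = (A P⁻¹)[s, :] P`. -/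
theorem submatrix_eq_submatrix_mul_inv_mul (A : Matrix m ι K) (r : ι → m)
    (hP : IsUnit (A.submatrix r id).det) (s : ι → m) :
    A.submatrix s id = (A * (A.submatrix r id)⁻¹).submatrix s id * A.submatrix r id := by
  rw [submatrix_mul A (A.submatrix r id)⁻¹ s id id Function.bijective_id, submatrix_id_id,
    Matrix.mul_assoc, nonsing_inv_mul _ hP, Matrix.mul_one]

/-- [cite: Osinsky2018, §2.2 Lemma 3]; [cite: MikhalevOseledets2018, §4]
VOLUME RATIO AS A MINOR OF THE COEFFICIENT MATRIX: `det A[s, :] = det (A P⁻¹)[s, :] · det P`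
for every `k`-row choice `s`, `P = A[r, :]` nonsingular. -/
theorem det_submatrix_eq_det_mul_det (A : Matrix m ι K) (r : ι → m)
    (hP : IsUnit (A.submatrix r id).det) (s : ι → m) :
    (A.submatrix s id).det =
      ((A * (A.submatrix r id)⁻¹).submatrix s id).det * (A.submatrix r id).det := by
  rw [← det_mul, ← submatrix_eq_submatrix_mul_inv_mul A r hP s]

end CommRing

/-! ## The exchange rule, the dominance criterion, termination of `maxvol` -/

section NormedField

variable {K : Type*} [NormedField K] {m ι : Type*} [Fintype ι] [DecidableEq ι]

/-- [cite: Osinsky2018, §2.2 Lemma 3]; [cite: MikhalevOseledets2018, §4]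
THE EXCHANGE RULE: replacing the `j`-th pivot row by row `i` of `A` multiplies the volume of the
pivot block by the modulus of the coefficient, `‖det A[update r j i, :]‖ = ‖(A P⁻¹) i j‖ · ‖det P‖`
(`V_new / V_old = |C i j|`). -/
theorem norm_det_submatrix_update (A : Matrix m ι K) (r : ι → m)
    (hP : IsUnit (A.submatrix r id).det) (i : m) (j : ι) :
    ‖(A.submatrix (Function.update r j i) id).det‖ =
      ‖(A * (A.submatrix r id)⁻¹) i j‖ * ‖(A.submatrix r id).det‖ := by
  rw [← norm_mul, mul_inv_submatrix_apply_mul_det A r hP i j]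

/-- [cite: MikhalevOseledets2018, §3 Definition 2]; [cite: Osinsky2018, §1 Definition 1];
[cite: AllenLaiShen2024, Definition 1]
THE DOMINANCE CRITERION (with threshold `c`): for a nonsingular pivot block `P = A[r, :]`, no
single row exchange multiplies the volume by more than `c` if and only if every coefficient
satisfies `‖(A P⁻¹) i j‖ ≤ c`.  For `c = 1` the left-hand side is the definition of a DOMINANT
submatrix ("swap of any single row of `P` for a row of `A` does not increase the volume") and the
right-hand side is `‖C‖_C ≤ 1` [MikhalevOseledets2018, §4], [Osinsky2018, §2.2 after Lemma 3];
`c = 1 + ε` is quasi-dominance. -/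
theorem forall_norm_det_submatrix_update_le_iff (A : Matrix m ι K) (r : ι → m)
    (hP : IsUnit (A.submatrix r id).det) (c : ℝ) :
    (∀ i j, ‖(A.submatrix (Function.update r j i) id).det‖ ≤ c * ‖(A.submatrix r id).det‖) ↔
      ∀ i j, ‖(A * (A.submatrix r id)⁻¹) i j‖ ≤ c := by
  have hdet : 0 < ‖(A.submatrix r id).det‖ := norm_pos_iff.mpr hP.ne_zero
  simp only [norm_det_submatrix_update A r hP, mul_le_mul_iff_left₀ hdet]

/-- [cite: AllenLaiShen2024, Lemma 1]; [cite: MikhalevOseledets2018, §4]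
EXISTENCE OF A DOMINANT BLOCK: if the tall matrix `A` (finitely many rows) has some nonsingular
`k × k` block of rows, then it has a dominant one — a block of maximal volume is nonsingular and
dominant (`‖(A P⁻¹) i j‖ ≤ 1` for all `i, j`). -/
theorem exists_isUnit_det_and_norm_mul_inv_le_one [Fintype m] (A : Matrix m ι K)
    (h : ∃ r : ι → m, IsUnit (A.submatrix r id).det) :
    ∃ r : ι → m, IsUnit (A.submatrix r id).det ∧
      ∀ i j, ‖(A * (A.submatrix r id)⁻¹) i j‖ ≤ 1 := by
  obtain ⟨r₁, hr₁⟩ := h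
  obtain ⟨r, -, hr⟩ := Finset.exists_max_image Finset.univ
    (fun r : ι → m => ‖(A.submatrix r id).det‖) ⟨r₁, Finset.mem_univ _⟩
  have hP : IsUnit (A.submatrix r id).det := by
    rw [isUnit_iff_ne_zero, ← norm_pos_iff]
    exact (norm_pos_iff.mpr hr₁.ne_zero).trans_le (hr r₁ (Finset.mem_univ _))
  refine ⟨r, hP, (forall_norm_det_submatrix_update_le_iff A r hP 1).mp fun i j => ?_⟩
  rw [one_mul]
  exact hr _ (Finset.mem_univ _)

/-- [cite: Osinsky2018, §2.2]; [cite: MikhalevOseledets2018, §4]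
ONE `maxvol` STEP: exchanging on an entry with `‖(A P⁻¹) i j‖ > c` multiplies the volume by more
than `c` (for `c = 1`: the volume strictly increases, which is why `maxvol` terminates). -/
theorem mul_norm_det_lt_norm_det_submatrix_update (A : Matrix m ι K) (r : ι → m)
    (hP : IsUnit (A.submatrix r id).det) {c : ℝ} {i : m} {j : ι}
    (h : c < ‖(A * (A.submatrix r id)⁻¹) i j‖) :
    c * ‖(A.submatrix r id).det‖ < ‖(A.submatrix (Function.update r j i) id).det‖ := by
  rw [norm_det_submatrix_update A r hP i j]
  exact mul_lt_mul_of_pos_right h (norm_pos_iff.mpr hP.ne_zero)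

/-- [cite: Osinsky2018, §2.2]
VOLUME GROWTH ALONG A `maxvol` RUN WITH THRESHOLD `c > 0`: let `rs 0, rs 1, …, rs k` be pivot-row
choices, each obtained from the previous one by ONE exchange,
`rs (t+1) = update (rs t) (js t) (is t)`, performed on an entry with
`‖(A P_t⁻¹) (is t) (js t)‖ ≥ c` (`P_t = A[rs t, :]`), starting from a nonsingular `P_0`.
Then `P_k` is nonsingular and `c ^ k · ‖det P_0‖ ≤ ‖det P_k‖`. -/
theorem isUnit_det_submatrix_and_le_of_exchanges (A : Matrix m ι K) (rs : ℕ → ι → m)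
    (is : ℕ → m) (js : ℕ → ι) {c : ℝ} (hc : 0 < c)
    (h0 : IsUnit (A.submatrix (rs 0) id).det) (k : ℕ)
    (hstep : ∀ t < k, rs (t + 1) = Function.update (rs t) (js t) (is t))
    (hgain : ∀ t < k, c ≤ ‖(A * (A.submatrix (rs t) id)⁻¹) (is t) (js t)‖) :
    IsUnit (A.submatrix (rs k) id).det ∧
      c ^ k * ‖(A.submatrix (rs 0) id).det‖ ≤ ‖(A.submatrix (rs k) id).det‖ := by
  induction k with
  | zero => exact ⟨h0, by simp⟩
  | succ k ih =>
    obtain ⟨hk, hvol⟩ := ih (fun t ht => hstep t (by omega)) (fun t ht => hgain t (by omega))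
    have hex : ‖(A.submatrix (rs (k + 1)) id).det‖ =
        ‖(A * (A.submatrix (rs k) id)⁻¹) (is k) (js k)‖ * ‖(A.submatrix (rs k) id).det‖ := by
      rw [hstep k (by omega), norm_det_submatrix_update A (rs k) hk]
    have hCpos : 0 < ‖(A * (A.submatrix (rs k) id)⁻¹) (is k) (js k)‖ :=
      hc.trans_le (hgain k (by omega))
    refine ⟨?_, ?_⟩
    · rw [isUnit_iff_ne_zero, ← norm_pos_iff, hex]
      exact mul_pos hCpos (norm_pos_iff.mpr hk.ne_zero)
    · calc c ^ (k + 1) * ‖(A.submatrix (rs 0) id).det‖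
            = c * (c ^ k * ‖(A.submatrix (rs 0) id).det‖) := by ring
        _ ≤ ‖(A * (A.submatrix (rs k) id)⁻¹) (is k) (js k)‖ *
              ‖(A.submatrix (rs k) id).det‖ :=
            mul_le_mul (hgain k (by omega)) hvol (by positivity) (norm_nonneg _)
        _ = ‖(A.submatrix (rs (k + 1)) id).det‖ := hex.symm

/-- [cite: Osinsky2018, §2.2]
TERMINATION COUNT OF `maxvol` WITH THRESHOLD `c > 1`: in the situation of
`isUnit_det_submatrix_and_le_of_exchanges`, if every `k × k` block of rows has volume at most `V`
(e.g. `V` = the maximal volume), the number `k` of exchanges satisfies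
`k ≤ log_c (V / ‖det P_0‖)`; [Osinsky2018, §2.2] states the count as `⌈ln Γ / ln c⌉ - 1`, `Γ` the
ratio of the maximal volume to the starting volume, for the strict comparison `|C i j| > c` (with
`c ^ k < Γ` strict, `k < log_c Γ`); here the comparison is `≥ c` and the bound is `k ≤ log_c Γ`. -/
theorem natCast_le_logb_of_exchanges (A : Matrix m ι K) (rs : ℕ → ι → m)
    (is : ℕ → m) (js : ℕ → ι) {c : ℝ} (hc : 1 < c)
    (h0 : IsUnit (A.submatrix (rs 0) id).det) (k : ℕ)
    (hstep : ∀ t < k, rs (t + 1) = Function.update (rs t) (js t) (is t))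
    (hgain : ∀ t < k, c ≤ ‖(A * (A.submatrix (rs t) id)⁻¹) (is t) (js t)‖) {V : ℝ}
    (hV : ∀ s : ι → m, ‖(A.submatrix s id).det‖ ≤ V) :
    (k : ℝ) ≤ Real.logb c (V / ‖(A.submatrix (rs 0) id).det‖) := by
  obtain ⟨-, hvol⟩ :=
    isUnit_det_submatrix_and_le_of_exchanges A rs is js (zero_lt_one.trans hc) h0 k hstep hgain
  have hd0 : 0 < ‖(A.submatrix (rs 0) id).det‖ := norm_pos_iff.mpr h0.ne_zero
  have hV0 : 0 < V := hd0.trans_le (hV (rs 0))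
  rw [Real.le_logb_iff_rpow_le hc (div_pos hV0 hd0), Real.rpow_natCast, le_div_iff₀ hd0]
  exact hvol.trans (hV (rs k))

end NormedField

/-! ## Quasi-maximal volume of dominant blocks (Hadamard) -/

section Complex

variable {m ι : Type*} [Fintype ι] [DecidableEq ι]

/-- [cite: Osinsky2018, proof of Proposition 2]
HADAMARD BOUND FOR BOUNDED ENTRIES: a `k × k` complex matrix with all entries of modulus `≤ c`
has `‖det C‖ ≤ (√k · c) ^ k = c ^ k k ^ {k/2}` (from Hadamard's inequality
`Literature.Analysis.Matrix.norm_det_sq_le_of_entry_le`). -/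
theorem norm_det_le_pow_of_norm_entry_le (C : Matrix ι ι ℂ) {c : ℝ} (hc : ∀ i j, ‖C i j‖ ≤ c) :
    ‖C.det‖ ≤ (Real.sqrt (Fintype.card ι) * c) ^ Fintype.card ι := by
  rcases isEmpty_or_nonempty ι with hι | hι
  · simp [Matrix.det_isEmpty, Fintype.card_eq_zero]
  obtain ⟨i₀⟩ := hι
  have hc0 : 0 ≤ c := (norm_nonneg _).trans (hc i₀ i₀)
  have hrt : (Real.sqrt (Fintype.card ι) * c) ^ 2 = (Fintype.card ι : ℝ) * c ^ 2 := by
    rw [mul_pow, Real.sq_sqrt (Nat.cast_nonneg _)]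
  have hH := Literature.Analysis.Matrix.norm_det_sq_le_of_entry_le C (fun _ => c) hc
  simp only [Finset.prod_const, Finset.card_univ] at hH
  have hsq : ‖C.det‖ ^ 2 ≤ ((Real.sqrt (Fintype.card ι) * c) ^ Fintype.card ι) ^ 2 := by
    rwa [← pow_mul, mul_comm (Fintype.card ι) 2, pow_mul, hrt]
  exact (pow_le_pow_iff_left₀ (norm_nonneg _)
    (pow_nonneg (mul_nonneg (Real.sqrt_nonneg _) hc0) _) two_ne_zero).mp hsq

/-- [cite: Osinsky2018, Proposition 2]; [cite: MikhalevOseledets2018, §3]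
QUASI-MAXIMAL VOLUME OF A `c`-DOMINANT BLOCK (complex, tall matrix): if the pivot block
`P = A[r, :]` is nonsingular and all coefficients satisfy `‖(A P⁻¹) i j‖ ≤ c` (e.g. the output of
`maxvol` run with threshold `c = 1 + ε`), then EVERY `k × k` block of rows has
`‖det A[s, :]‖ ≤ (√k · c) ^ k · ‖det P‖`: the volume of `P` is within the factor `c ^ k k ^ {k/2}`
of the maximal volume — the hypothesis "`Γ = c ^ r r ^ {r/2}` (for example, after the algorithm
`maxvol` with the parameter `c`)" of [Osinsky2018, Prop. 2] and the first sentence of its proof. -/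
theorem norm_det_submatrix_le_of_norm_mul_inv_le (A : Matrix m ι ℂ) (r : ι → m)
    (hP : IsUnit (A.submatrix r id).det) {c : ℝ}
    (hC : ∀ i j, ‖(A * (A.submatrix r id)⁻¹) i j‖ ≤ c) (s : ι → m) :
    ‖(A.submatrix s id).det‖ ≤
      (Real.sqrt (Fintype.card ι) * c) ^ Fintype.card ι * ‖(A.submatrix r id).det‖ := by
  rw [det_submatrix_eq_det_mul_det A r hP s, norm_mul]
  exact mul_le_mul_of_nonneg_right
    (norm_det_le_pow_of_norm_entry_le _ fun a b => hC (s a) b) (norm_nonneg _)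

/-- [cite: AllenLaiShen2024, Lemma 2]; [cite: Osinsky2018, Proposition 2]
A DOMINANT BLOCK HAS QUASI-MAXIMAL VOLUME (complex): if `‖(A P⁻¹) i j‖ ≤ 1` for all `i, j` then
`‖det A[s, :]‖ ≤ k ^ {k/2} · ‖det P‖` for every `k`-row block, i.e.
`|det P| ≥ |det P_max| / k ^ {k/2}`. -/
theorem norm_det_submatrix_le_of_dominant (A : Matrix m ι ℂ) (r : ι → m)
    (hP : IsUnit (A.submatrix r id).det)
    (hC : ∀ i j, ‖(A * (A.submatrix r id)⁻¹) i j‖ ≤ 1) (s : ι → m) :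
    ‖(A.submatrix s id).det‖ ≤
      Real.sqrt (Fintype.card ι) ^ Fintype.card ι * ‖(A.submatrix r id).det‖ := by
  simpa using norm_det_submatrix_le_of_norm_mul_inv_le A r hP hC s

end Complex

section Real

variable {m ι : Type*} [Fintype ι] [DecidableEq ι]

/-- [cite: Osinsky2018, proof of Proposition 2]
HADAMARD BOUND FOR BOUNDED ENTRIES (real): a `k × k` real matrix with all entries of modulus
`≤ c` has `|det C| ≤ (√k · c) ^ k` (from the complex statement by base change along `ℝ → ℂ`). -/
theorem abs_det_le_pow_of_abs_entry_le (C : Matrix ι ι ℝ) {c : ℝ} (hc : ∀ i j, |C i j| ≤ c) :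
    |C.det| ≤ (Real.sqrt (Fintype.card ι) * c) ^ Fintype.card ι := by
  have h := norm_det_le_pow_of_norm_entry_le (Complex.ofRealHom.mapMatrix C) (c := c)
    (fun i j => by
      rw [RingHom.mapMatrix_apply, map_apply, Complex.ofRealHom_eq_coe, Complex.norm_real,
        Real.norm_eq_abs]
      exact hc i j)
  rwa [← RingHom.map_det, Complex.ofRealHom_eq_coe, Complex.norm_real, Real.norm_eq_abs] at h

/-- [cite: Osinsky2018, Proposition 2]; [cite: MikhalevOseledets2018, §3]
QUASI-MAXIMAL VOLUME OF A `c`-DOMINANT BLOCK (real, tall matrix): if `P = A[r, :]` is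
nonsingular and `|(A P⁻¹) i j| ≤ c` for all `i, j`, then `|det A[s, :]| ≤ (√k · c) ^ k · |det P|`
for every `k`-row block `s`. -/
theorem abs_det_submatrix_le_of_abs_mul_inv_le (A : Matrix m ι ℝ) (r : ι → m)
    (hP : IsUnit (A.submatrix r id).det) {c : ℝ}
    (hC : ∀ i j, |(A * (A.submatrix r id)⁻¹) i j| ≤ c) (s : ι → m) :
    |(A.submatrix s id).det| ≤
      (Real.sqrt (Fintype.card ι) * c) ^ Fintype.card ι * |(A.submatrix r id).det| := by
  rw [det_submatrix_eq_det_mul_det A r hP s, abs_mul]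
  exact mul_le_mul_of_nonneg_right
    (abs_det_le_pow_of_abs_entry_le _ fun a b => hC (s a) b) (abs_nonneg _)

/-- [cite: AllenLaiShen2024, Lemma 2]; [cite: Osinsky2018, Proposition 2]
A DOMINANT BLOCK HAS QUASI-MAXIMAL VOLUME (real): `|(A P⁻¹) i j| ≤ 1` for all `i, j` implies
`|det A[s, :]| ≤ k ^ {k/2} · |det P|` for every `k`-row block `s` — equivalently
`|det P| ≥ |det P_max| / k ^ {k/2}` for every dominant `P`. -/
theorem abs_det_submatrix_le_of_dominant (A : Matrix m ι ℝ) (r : ι → m)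
    (hP : IsUnit (A.submatrix r id).det)
    (hC : ∀ i j, |(A * (A.submatrix r id)⁻¹) i j| ≤ 1) (s : ι → m) :
    |(A.submatrix s id).det| ≤
      Real.sqrt (Fintype.card ι) ^ Fintype.card ι * |(A.submatrix r id).det| := by
  simpa using abs_det_submatrix_le_of_abs_mul_inv_le A r hP hC s

/-- [cite: AllenLaiShen2024, Lemma 2]; [cite: AllenLaiShen2024, Lemma 1]
LOCAL MAXIMALITY IS QUASI-GLOBAL: if the volume `|det P|` of a nonsingular pivot block cannot be
increased by exchanging ONE pivot row (the stopping condition of `maxvol`), then it is within the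
factor `k ^ {k/2}` of the volume of every `k × k` block of rows, in particular of the block of
globally maximal volume (`abs_mul_inv_submatrix_le_one_of_volume_maximal` of
`Literature.LinearAlgebra.Matrix.MaximalVolumePivot` combined with
`abs_det_submatrix_le_of_dominant`). -/
theorem abs_det_submatrix_le_of_volume_locally_maximal (A : Matrix m ι ℝ) (r : ι → m)
    (hP : IsUnit (A.submatrix r id).det)
    (hmax : ∀ i j, |(A.submatrix (Function.update r j i) id).det| ≤ |(A.submatrix r id).det|)
    (s : ι → m) :
    |(A.submatrix s id).det| ≤
      Real.sqrt (Fintype.card ι) ^ Fintype.card ι * |(A.submatrix r id).det| :=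
  abs_det_submatrix_le_of_dominant A r hP
    (abs_mul_inv_submatrix_le_one_of_volume_maximal A r hP hmax) s

end Real

/-! ## The Lebesgue constant of `γ`-dominant interpolation nodes -/

section Ordered

variable {K : Type*} [CommRing K] [LinearOrder K] [IsStrictOrderedRing K]
variable {m n ι : Type*} [Fintype ι] [DecidableEq ι]

/-- [cite: GoreinovTyrtyshnikov2001, Thm 1.1]; [cite: MikhalevOseledets2018, §4]
INTERPOLATION ON `γ`-DOMINANT NODES, `E_int ≤ (1 + k γ) E_best`: the argument of
[GoreinovTyrtyshnikov2001, Thm 1.1] with its maximal-volume hypothesis (used there only through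
the dominance `|det Mᵢ / det M| ≤ 1` of the node matrix `M = A[r, c]` among the columns of
`A[r, :]`) replaced by the weaker `γ`-dominance `|(M⁻¹ A[r, :]) t j| ≤ γ` for all `t, j` — e.g.
`γ = c` for nodes produced by `maxvol` with threshold `c` (the transposed form of
`forall_norm_det_submatrix_update_le_iff`).  In the finite form of
`Literature.LinearAlgebra.Matrix.abs_sub_crossInterp_le_of_pivotCols_volume_maximal` (rows of `A`
= the functions, `f` = row `i`, interpolant = row `i` of `crossInterp A r c`): every competitor
`u = Σ α_s u_s` with `‖f - u‖_C ≤ δ` gives `|(A - Ã) i j| ≤ (1 + k γ) δ`; `γ = 1` is the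
original `(k+1) δ`. -/
theorem abs_sub_crossInterp_le_of_pivotCols_dominant (A : Matrix m n K) (r : ι → m)
    (c : ι → n) (hP : IsUnit (A.submatrix r c).det) {γ : K}
    (hdom : ∀ t j, |((A.submatrix r c)⁻¹ * A.submatrix r id) t j| ≤ γ)
    (i : m) (α : ι → K) {δ : K} (hα : ∀ t, |A i t - (α ᵥ* A.submatrix r id) t| ≤ δ) (j : n) :
    |(A - crossInterp A r c) i j| ≤ (1 + Fintype.card ι * γ) * δ := by
  -- the coefficient vector of the interpolant: row `i` of `A[:, c] P⁻¹`
  have hci : crossInterp A r c i j =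
      ((fun t => (A.submatrix id c * (A.submatrix r c)⁻¹) i t) ᵥ* A.submatrix r id) j := by
    simp [crossInterp, Matrix.mul_apply, vecMul, dotProduct]
  -- values at the nodes
  have hαP : α ᵥ* A.submatrix r c = fun t => (α ᵥ* A.submatrix r id) (c t) := by
    ext t; simp [vecMul, dotProduct]
  have hβP : (fun t => (A.submatrix id c * (A.submatrix r c)⁻¹) i t) ᵥ* A.submatrix r c =
      fun t => A i (c t) := by
    ext t
    have h := congr_fun (congr_fun (nonsing_inv_mul_cancel_right _ (A.submatrix id c) hP) i) t
    rw [Matrix.mul_apply] at h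
    simpa [vecMul, dotProduct] using h
  -- the difference of the coefficient vectors is `ρ P⁻¹`, `ρ` the residual of `α` at the nodes
  have hαβ : α - (fun t => (A.submatrix id c * (A.submatrix r c)⁻¹) i t) =
      (fun t => (α ᵥ* A.submatrix r id) (c t) - A i (c t)) ᵥ* (A.submatrix r c)⁻¹ := by
    have h1 : (α - fun t => (A.submatrix id c * (A.submatrix r c)⁻¹) i t) ᵥ* A.submatrix r c =
        fun t => (α ᵥ* A.submatrix r id) (c t) - A i (c t) := by
      rw [sub_vecMul, hαP, hβP]; rfl
    rw [← h1, vecMul_vecMul, mul_nonsing_inv _ hP, vecMul_one]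
  -- error decomposition `f - u_int = (f - u) + (α - β) R`, `(α - β) R = ρ (P⁻¹ R)`
  have hE : (A - crossInterp A r c) i j = (A i j - (α ᵥ* A.submatrix r id) j) +
      ∑ t, ((α ᵥ* A.submatrix r id) (c t) - A i (c t)) *
        ((A.submatrix r c)⁻¹ * A.submatrix r id) t j := by
    have h2 : ((α - fun t => (A.submatrix id c * (A.submatrix r c)⁻¹) i t) ᵥ* A.submatrix r id) j =
        ∑ t, ((α ᵥ* A.submatrix r id) (c t) - A i (c t)) *
          ((A.submatrix r c)⁻¹ * A.submatrix r id) t j := by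
      rw [hαβ, vecMul_vecMul]; simp [vecMul, dotProduct]
    rw [Matrix.sub_apply, hci, ← h2, sub_vecMul, Pi.sub_apply]; ring
  have hδ0 : 0 ≤ δ := (abs_nonneg _).trans (hα j)
  rw [hE]
  calc |A i j - (α ᵥ* A.submatrix r id) j +
        ∑ t, ((α ᵥ* A.submatrix r id) (c t) - A i (c t)) *
          ((A.submatrix r c)⁻¹ * A.submatrix r id) t j|
      ≤ |A i j - (α ᵥ* A.submatrix r id) j| +
        ∑ t, |((α ᵥ* A.submatrix r id) (c t) - A i (c t)) *
          ((A.submatrix r c)⁻¹ * A.submatrix r id) t j| :=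
        (abs_add_le _ _).trans (add_le_add le_rfl (Finset.abs_sum_le_sum_abs _ _))
    _ ≤ δ + ∑ _t : ι, δ * γ := by
        refine add_le_add (hα j) (Finset.sum_le_sum fun t _ => ?_)
        rw [abs_mul, abs_sub_comm]
        exact mul_le_mul (hα (c t)) (hdom t j) (abs_nonneg _) hδ0
    _ = (1 + Fintype.card ι * γ) * δ := by
        rw [Finset.sum_const, Finset.card_univ, nsmul_eq_mul]; ring

end Ordered

end Literature.LinearAlgebra.Matrix
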